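import Summits.ResolutionOfSingularities.ResolutionOfSingularities.Theorems.DeltaCutGradeCertificates
import HarnessLib

/-!
# DeltaCutGradeCertificates2 — decomp-res node «GradeCut (certificates)» (lens-6 g28, critic row 210 CLEARED), tree
file 2/5 of the node

Content VERBATIM from the decomp-res lens-6 g28 certificate files
`HOME/decomp-res-lens-6/g28/GradeCutCertificates.lean` (92912ba2) + `GradeCutCertificates2.lean` (5886ffab) (ring
level, import the landed `DeltaCutRefCertificates3`; namespace `…Theorems.DeltaCutClasses`, sections
`GCertificatesA/B/C`); HOME = run/shared/lean/pub/decomp-res; critic CRITIC-LEDGER row 210 CLEARED; landing orders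
NEXT-g29.md §4 (B)/(C) + INBOX 11:01:55Z — provenance, critic text and the first lens header in full in
`DeltaCutGradeCertificates`.  `--kind proof --supports stmt-ResolutionOfSingularities-26971`.

## This file

Continuation 2/5 of `DeltaCutGradeCertificates` (same namespace / sections of the node, cut at the tree's 400-line
cap; section variables / opens replayed): scopes `GCertificatesA`, `GCertificatesB` — carries `H_top`, `H_wild`,
`H_coords`, `H_plane`, `H_surface_singular`, `H_gFrozen_certificate`, `G0_A_charts`, `G0_A_chart_z_noTop`.

[WRITER NOTE (decomp-res writer g13): file split only (tree files ≤ 400 lines, cut at declaration boundaries; the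
two lens files form one linear chain); namespace, the sections `GCertificatesA/B/C` with their `open MvPolynomial` /
`variable {K : Type*} [Field K]`, and every declaration exactly as in the lens (the HOME-only dupNamespace-linter
lines are dropped — the library sets it; `noncomputable section`, the file-level `open` lines, `universe u` and
`open …Rescue.BedZpeBinom4Centre (mul_mem_pow_add)` are replayed in every part).]

(Sources: Hironaka1967; CossartJannsenSaito2020 Def. 3.13 / Thm. 3.14, Ch. 5–8; CossartPiltant2019 Prop. 2.6;
Giraud1975; EGAIV4 §16–§18; StacksProject 0804 / 0BIQ / 035A; Matsumura1987 §28–§31; Kollar2007 §3.)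
-/

noncomputable section

open CategoryTheory CategoryTheory.Limits AlgebraicGeometry TopologicalSpace IsLocalRing
open Literature.AlgebraicGeometry.Resolution

universe u

open Summit.ResolutionOfSingularities.ResolutionOfSingularities.Theorems.Rescue.BedZpeBinom4Centre (mul_mem_pow_add)

namespace Summit.ResolutionOfSingularities.ResolutionOfSingularities.Theorems.DeltaCutClasses

open Summit.ResolutionOfSingularities.ResolutionOfSingularities.Theorems.TwistCutClasses
open Summit.ResolutionOfSingularities.ResolutionOfSingularities.Theorems.LightCutClasses

section GCertificatesA

open MvPolynomial
variable {K : Type*} [Field K]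

/-! #### H = `z³ + (t²w − u²)⁴` — the F-surf-sing inhabitant: an IRREGULAR irreducible surface as bad closure -/

/-- **H — THE TOP LOCUS lies in the surface `W = V(z, t²w − u²)`**: a prime of order `≥ 3` contains `g = t²w − u²` (else `∂_w H
= 4t²g³` and `∂_u H = −8u·g³` force `t, u ∈ 𝔮`, so `g ∈ 𝔮`) and then `z` (`z³ = H − g⁴`). [new; elementary] [folklore] -/
theorem H_top [CharP K 3] (𝔮 : Ideal (MvPolynomial (Fin 4) K)) [𝔮.IsPrime] {s : MvPolynomial (Fin 4) K} (hs : s ∉ 𝔮)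
    (h : s * (X 0 ^ 3 + (X 1 ^ 2 * X 3 - X 2 ^ 2) ^ 4 : MvPolynomial (Fin 4) K) ∈ 𝔮 ^ 3) :
    (X 0 : MvPolynomial (Fin 4) K) ∈ 𝔮 ∧ (X 1 ^ 2 * X 3 - X 2 ^ 2 : MvPolynomial (Fin 4) K) ∈ 𝔮 := by
  have hP := ‹𝔮.IsPrime›
  have hs2 : s ^ 2 ∉ 𝔮 := pow_not_mem 𝔮 hs 2
  have h4 : (4 : MvPolynomial (Fin 4) K) ∉ 𝔮 := by
    have := natCast_not_mem (K := K) 𝔮 (m := 4) (by decide)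
    exact_mod_cast this
  have h2 : (2 : MvPolynomial (Fin 4) K) ∉ 𝔮 := by
    have := natCast_not_mem (K := K) 𝔮 (m := 2) (by decide)
    exact_mod_cast this
  have e20 := f_ne K (i := 2) (j := 0) (by decide)
  have e21 := f_ne K (i := 2) (j := 1) (by decide)
  have e23 := f_ne K (i := 2) (j := 3) (by decide)
  have e22 := f_self K 2
  have e30 := f_ne K (i := 3) (j := 0) (by decide)
  have e31 := f_ne K (i := 3) (j := 1) (by decide)
  have e32 := f_ne K (i := 3) (j := 2) (by decide)
  have e33 := f_self K 3
  have d3 : pderiv 3 (X 0 ^ 3 + (X 1 ^ 2 * X 3 - X 2 ^ 2) ^ 4 : MvPolynomial (Fin 4) K) =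
      4 * (X 1 ^ 2 * (X 1 ^ 2 * X 3 - X 2 ^ 2) ^ 3) ^ 1 := by
    simp only [map_add, map_sub, Derivation.leibniz, Derivation.leibniz_pow, smul_eq_mul, nsmul_eq_mul, e30, e31, e32, e33]
    push_cast; ring
  have d2 : pderiv 2 (X 0 ^ 3 + (X 1 ^ 2 * X 3 - X 2 ^ 2) ^ 4 : MvPolynomial (Fin 4) K) =
      (4 * -2) * (X 2 * (X 1 ^ 2 * X 3 - X 2 ^ 2) ^ 3) ^ 1 := by
    simp only [map_add, map_sub, Derivation.leibniz, Derivation.leibniz_pow, smul_eq_mul, nsmul_eq_mul, e20, e21, e22, e23]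
    push_cast; ring
  have h42 : (4 * -2 : MvPolynomial (Fin 4) K) ∉ 𝔮 := by
    intro hm
    rcases hP.mem_or_mem hm with hm | hm
    · exact h4 hm
    · exact h2 ((Ideal.neg_mem_iff _).1 hm)
  have h13 := sq_mul_deriv_mem_pow 𝔮 h (pderiv 3)
  rw [d3] at h13
  have hA : (X 1 ^ 2 * (X 1 ^ 2 * X 3 - X 2 ^ 2) ^ 3 : MvPolynomial (Fin 4) K) ∈ 𝔮 := mem_of_mul_mul_pow_mem_pow 𝔮 two_ne_zero hs2 h4 h13
  have h12 := sq_mul_deriv_mem_pow 𝔮 h (pderiv 2)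
  rw [d2] at h12
  have hB : (X 2 * (X 1 ^ 2 * X 3 - X 2 ^ 2) ^ 3 : MvPolynomial (Fin 4) K) ∈ 𝔮 := mem_of_mul_mul_pow_mem_pow 𝔮 two_ne_zero hs2 h42 h12
  have hg : (X 1 ^ 2 * X 3 - X 2 ^ 2 : MvPolynomial (Fin 4) K) ∈ 𝔮 := by
    by_contra hg
    have hg3 : (X 1 ^ 2 * X 3 - X 2 ^ 2 : MvPolynomial (Fin 4) K) ^ 3 ∉ 𝔮 := pow_not_mem 𝔮 hg 3
    have h1 : (X 1 : MvPolynomial (Fin 4) K) ∈ 𝔮 := by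
      rcases hP.mem_or_mem hA with h | h
      · exact hP.mem_of_pow_mem 2 h
      · exact absurd h hg3
    have hu : (X 2 : MvPolynomial (Fin 4) K) ∈ 𝔮 := by
      rcases hP.mem_or_mem hB with h | h
      · exact h
      · exact absurd h hg3
    exact hg (Ideal.sub_mem _ (Ideal.mul_mem_right _ _ (Ideal.pow_mem_of_mem 𝔮 h1 2 (by norm_num)))
      (Ideal.pow_mem_of_mem 𝔮 hu 2 (by norm_num)))
  have hf : (X 0 ^ 3 + (X 1 ^ 2 * X 3 - X 2 ^ 2) ^ 4 : MvPolynomial (Fin 4) K) ∈ 𝔮 := mem_of_sMul_mem_cube 𝔮 hs h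
  have h0 : (X 0 : MvPolynomial (Fin 4) K) ^ 3 ∈ 𝔮 := by
    have := Ideal.sub_mem _ hf (Ideal.pow_mem_of_mem 𝔮 hg 4 (by norm_num))
    rwa [add_sub_cancel_right] at this
  exact ⟨hP.mem_of_pow_mem 3 h0, hg⟩

/-- **H — WILD at every point of `W`**: `H ∈ (z, g)³` and `g⁴ ∈ (z,g)⁴` (`H = z³ + r`, `r ∈ 𝔫_c⁴` at every `c ∈ W`: a 3-power
form).  [new; elementary] [folklore] -/
theorem H_wild :
    (X 0 ^ 3 + (X 1 ^ 2 * X 3 - X 2 ^ 2) ^ 4 : MvPolynomial (Fin 4) K) ∈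
        (Ideal.span {(X 0 : MvPolynomial (Fin 4) K), X 1 ^ 2 * X 3 - X 2 ^ 2}) ^ 3 ∧
      ((X 1 ^ 2 * X 3 - X 2 ^ 2) ^ 4 : MvPolynomial (Fin 4) K) ∈
        (Ideal.span {(X 0 : MvPolynomial (Fin 4) K), X 1 ^ 2 * X 3 - X 2 ^ 2}) ^ 4 := by
  have hz : (X 0 : MvPolynomial (Fin 4) K) ∈ Ideal.span {(X 0 : MvPolynomial (Fin 4) K), X 1 ^ 2 * X 3 - X 2 ^ 2} :=
    Ideal.subset_span (by simp)
  have hg : (X 1 ^ 2 * X 3 - X 2 ^ 2 : MvPolynomial (Fin 4) K) ∈ Ideal.span {(X 0 : MvPolynomial (Fin 4) K), X 1 ^ 2 * X 3 - X 2 ^ 2} :=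
    Ideal.subset_span (by simp)
  have hg4 := Ideal.pow_mem_pow hg 4
  exact ⟨Ideal.add_mem _ (Ideal.pow_mem_pow hz 3) (Ideal.pow_le_pow_right (by norm_num) hg4), hg4⟩

/-- **H — DICTIONARY (E′): on `D(t)` the map `(z,t,u,w) ↦ (z,t,u,g)` is a change of coordinates** (`w = (g +
u²)/t²`; its Jacobian
is `∂_w g = t²`, a unit on `D(t)`), and `H = B(z,t,u,g)` with `B := z³ + g⁴` LITERALLY (`aeval`): every order / top / wild /
near statement for `H` at a prime `𝔮 ∌ t` is the corresponding statement for `B` in the coordinates `(X₀, X₁, X₂, X₃) = (z, t,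
u, g)`. [new; elementary] [folklore] -/
theorem H_coords :
    aeval (fun j : Fin 4 => if j = 3 then (X 1 ^ 2 * X 3 - X 2 ^ 2 : MvPolynomial (Fin 4) K) else X j)
        (X 0 ^ 3 + X 3 ^ 4 : MvPolynomial (Fin 4) K) = X 0 ^ 3 + (X 1 ^ 2 * X 3 - X 2 ^ 2) ^ 4 ∧
      pderiv 3 (X 1 ^ 2 * X 3 - X 2 ^ 2 : MvPolynomial (Fin 4) K) = X 1 ^ 2 := by
  refine ⟨by simp, ?_⟩
  have e31 := f_ne K (i := 3) (j := 1) (by decide)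
  have e32 := f_ne K (i := 3) (j := 2) (by decide)
  have e33 := f_self K 3
  simp only [map_sub, Derivation.leibniz, Derivation.leibniz_pow, smul_eq_mul, nsmul_eq_mul, e31, e32, e33]
  push_cast; ring

/-- **H — IN THE COORDINATES `(z,t,u,g)`: the PLANE `V(z,g)` of `B = z³ + g⁴`** lies in the top locus (`B ∈ (z,g)³`), is a PLANE
(`t, u ∉ (z,g)`), is WILD at every point (`g⁴ ∈ (z,g)⁴`), and every closed point `c = (0, c₁, c₂, 0)` of it has a NEAR point
(chart `τ = t − c₁` of the point blow-up at `c`: `z'³ + τ·g'⁴·H' ∈ 𝔫'³` for every cofactor `H'`) — B_S's level-1 plane germ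
(`BS_L1_plane`).  Read through (E′): bad₀(H) `⊇` all closed points of `W ∩ D(t)`. [new; elementary] [folklore] -/
theorem H_plane :
    (X 0 ^ 3 + X 3 ^ 4 : MvPolynomial (Fin 4) K) ∈ (Ideal.span {(X 0 : MvPolynomial (Fin 4) K), X 3}) ^ 3 ∧
      ((X 1 : MvPolynomial (Fin 4) K) ∉ Ideal.span {(X 0 : MvPolynomial (Fin 4) K), X 3} ∧
        (X 2 : MvPolynomial (Fin 4) K) ∉ Ideal.span {(X 0 : MvPolynomial (Fin 4) K), X 3}) ∧
      (X 3 ^ 4 : MvPolynomial (Fin 4) K) ∈ (Ideal.span {(X 0 : MvPolynomial (Fin 4) K), X 3}) ^ 4 ∧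
      ∀ H' : MvPolynomial (Fin 4) K, (X 0 ^ 3 + X 1 * (X 3 ^ 4 * H') : MvPolynomial (Fin 4) K) ∈
        (Ideal.span {(X 0 : MvPolynomial (Fin 4) K), X 1, X 2, X 3}) ^ 3 := by
  have hX0 : (X 0 : MvPolynomial (Fin 4) K) ∈ Ideal.span {(X 0 : MvPolynomial (Fin 4) K), X 3} := Ideal.subset_span (by simp)
  have hX3 : (X 3 : MvPolynomial (Fin 4) K) ∈ Ideal.span {(X 0 : MvPolynomial (Fin 4) K), X 3} := Ideal.subset_span (by simp)
  have hr : (X 3 ^ 4 : MvPolynomial (Fin 4) K) ∈ (Ideal.span {(X 0 : MvPolynomial (Fin 4) K), X 3}) ^ 4 := Ideal.pow_mem_pow hX3 4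
  refine ⟨Ideal.add_mem _ (Ideal.pow_mem_pow hX0 3) (Ideal.pow_le_pow_right (by norm_num) hr), ⟨?_, ?_⟩, hr, fun H' => ?_⟩
  · refine not_mem_span_of_eval _ (fun i => if i = 1 then 1 else 0) ?_ (by simp)
    intro g hg
    simp only [Set.mem_insert_iff, Set.mem_singleton_iff] at hg
    rcases hg with rfl | rfl <;> simp
  · refine not_mem_span_of_eval _ (fun i => if i = 2 then 1 else 0) ?_ (by simp)
    intro g hg
    simp only [Set.mem_insert_iff, Set.mem_singleton_iff] at hg
    rcases hg with rfl | rfl <;> simp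
  · refine Ideal.add_mem _ (Ideal.pow_mem_pow (X_mem_spanX4 0) 3) ?_
    have h5 : (X 1 * X 3 ^ 4 : MvPolynomial (Fin 4) K) ∈ (Ideal.span {(X 0 : MvPolynomial (Fin 4) K), X 1, X 2, X 3}) ^ (1 + 4) :=
      mul_mem_pow_add (by rw [pow_one]; exact X_mem_spanX4 1) (Ideal.pow_mem_pow (X_mem_spanX4 3) 4)
    have := Ideal.mul_mem_right H' _ (Ideal.pow_le_pow_right (show 3 ≤ 1 + 4 by norm_num) h5)
    rwa [show (X 1 * X 3 ^ 4 * H' : MvPolynomial (Fin 4) K) = X 1 * (X 3 ^ 4 * H') by ring] at this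

/-- **H — DICTIONARY (R′): THE SURFACE `W = V(z, g)` IS NOT REGULAR AT THE ORIGIN and is NOT A CURVE**: `g = t²w − u² ∈ 𝔫₀²`, so
`𝒪_{W,0} = k[z,t,u,w]_{𝔫₀}/(z, g)` has embedding dimension `3`, while `W` — a hypersurface of `V(z) ≅ 𝔸³` — has dimension `2`
everywhere (`t, u ∉ (z, g)`: two independent directions; the points `(0, a, ab, b²)` exhaust `W ∩ D(t)`); `g ≠ 0`. So `¬
ClosureRegular`, `¬ DimLEOne` AND the surface part (`= W`) is IRREGULAR: `¬ TopFrozen`. [new; elementary] [folklore] -/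
theorem H_surface_singular :
    (X 1 ^ 2 * X 3 - X 2 ^ 2 : MvPolynomial (Fin 4) K) ∈ (Ideal.span {(X 0 : MvPolynomial (Fin 4) K), X 1, X 2, X 3}) ^ 2 ∧
      ((X 1 : MvPolynomial (Fin 4) K) ∉ Ideal.span {(X 0 : MvPolynomial (Fin 4) K), X 1 ^ 2 * X 3 - X 2 ^ 2} ∧
        (X 2 : MvPolynomial (Fin 4) K) ∉ Ideal.span {(X 0 : MvPolynomial (Fin 4) K), X 1 ^ 2 * X 3 - X 2 ^ 2}) ∧
      (X 1 ^ 2 * X 3 - X 2 ^ 2 : MvPolynomial (Fin 4) K) ≠ 0 := by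
  refine ⟨?_, ⟨?_, ?_⟩, ?_⟩
  · have h13 : (X 1 ^ 2 * X 3 : MvPolynomial (Fin 4) K) ∈ (Ideal.span {(X 0 : MvPolynomial (Fin 4) K), X 1, X 2, X 3}) ^ 2 :=
      Ideal.mul_mem_right _ _ (Ideal.pow_mem_pow (X_mem_spanX4 1) 2)
    exact Ideal.sub_mem _ h13 (Ideal.pow_mem_pow (X_mem_spanX4 2) 2)
  · refine not_mem_span_of_eval _ (fun i => if i = 1 then 1 else 0) ?_ (by simp)
    intro g hg
    simp only [Set.mem_insert_iff, Set.mem_singleton_iff] at hg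
    rcases hg with rfl | rfl <;> simp
  · refine not_mem_span_of_eval _ (fun i => if i = 0 then 0 else 1) ?_ (by simp)
    intro g hg
    simp only [Set.mem_insert_iff, Set.mem_singleton_iff] at hg
    rcases hg with rfl | rfl <;> simp
  · intro h0
    have := congr_arg (eval (fun i : Fin 4 => if i = 2 then (1 : K) else 0)) h0
    simp at this

/-- **H — THE G-FROZEN CERTIFICATE WITH A SINGULAR SURFACE PART (`GFrozen 3 ⟨(𝔸⁴, (H)), none⟩` at g-height `0`; the named
complement F-surf-sing of F-top INHABITED).**  (T) top locus `⊆ W = V(z, g)` (`H_top`), (W) WILD at every point of `W`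
(`H_wild`), (E′)+(P) through the coordinate change on `D(t)`, every closed point of `W ∩ D(t)` is a plane point of B_S type:
WILD with a NEAR point — bad₀ is dense in the irreducible surface `W` (closure bad₀ `= W`, nonempty), (R′) `W` is
singular at the
origin and not a curve (`H_surface_singular`): separating test, curve test AND surface-part test all FAIL at level `0` — the g28
run STAYS: `GFrozen` with the empty moving prefix. [new] [folklore] -/
theorem H_gFrozen_certificate [CharP K 3] :
    -- (T) top ⊆ W
    (∀ (𝔮 : Ideal (MvPolynomial (Fin 4) K)) [𝔮.IsPrime], ∀ s ∉ 𝔮,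
        s * (X 0 ^ 3 + (X 1 ^ 2 * X 3 - X 2 ^ 2) ^ 4 : MvPolynomial (Fin 4) K) ∈ 𝔮 ^ 3 →
          (X 0 : MvPolynomial (Fin 4) K) ∈ 𝔮 ∧ (X 1 ^ 2 * X 3 - X 2 ^ 2 : MvPolynomial (Fin 4) K) ∈ 𝔮) ∧
    -- (W) wild along W
      ((X 0 ^ 3 + (X 1 ^ 2 * X 3 - X 2 ^ 2) ^ 4 : MvPolynomial (Fin 4) K) ∈
          (Ideal.span {(X 0 : MvPolynomial (Fin 4) K), X 1 ^ 2 * X 3 - X 2 ^ 2}) ^ 3 ∧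
        ((X 1 ^ 2 * X 3 - X 2 ^ 2) ^ 4 : MvPolynomial (Fin 4) K) ∈
          (Ideal.span {(X 0 : MvPolynomial (Fin 4) K), X 1 ^ 2 * X 3 - X 2 ^ 2}) ^ 4) ∧
    -- (E′) the coordinate change on D(t) and its Jacobian
      (aeval (fun j : Fin 4 => if j = 3 then (X 1 ^ 2 * X 3 - X 2 ^ 2 : MvPolynomial (Fin 4) K) else X j)
          (X 0 ^ 3 + X 3 ^ 4 : MvPolynomial (Fin 4) K) = X 0 ^ 3 + (X 1 ^ 2 * X 3 - X 2 ^ 2) ^ 4 ∧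
        pderiv 3 (X 1 ^ 2 * X 3 - X 2 ^ 2 : MvPolynomial (Fin 4) K) = X 1 ^ 2) ∧
    -- (P) the plane germ of B = z³ + g⁴: top, plane, wild, near
      ((X 0 ^ 3 + X 3 ^ 4 : MvPolynomial (Fin 4) K) ∈ (Ideal.span {(X 0 : MvPolynomial (Fin 4) K), X 3}) ^ 3 ∧
        ((X 1 : MvPolynomial (Fin 4) K) ∉ Ideal.span {(X 0 : MvPolynomial (Fin 4) K), X 3} ∧
          (X 2 : MvPolynomial (Fin 4) K) ∉ Ideal.span {(X 0 : MvPolynomial (Fin 4) K), X 3}) ∧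
        (X 3 ^ 4 : MvPolynomial (Fin 4) K) ∈ (Ideal.span {(X 0 : MvPolynomial (Fin 4) K), X 3}) ^ 4 ∧
        ∀ H' : MvPolynomial (Fin 4) K, (X 0 ^ 3 + X 1 * (X 3 ^ 4 * H') : MvPolynomial (Fin 4) K) ∈
          (Ideal.span {(X 0 : MvPolynomial (Fin 4) K), X 1, X 2, X 3}) ^ 3) ∧
    -- (R′) W singular at the origin, not a curve, g ≠ 0
      ((X 1 ^ 2 * X 3 - X 2 ^ 2 : MvPolynomial (Fin 4) K) ∈ (Ideal.span {(X 0 : MvPolynomial (Fin 4) K), X 1, X 2, X 3}) ^ 2 ∧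
        ((X 1 : MvPolynomial (Fin 4) K) ∉ Ideal.span {(X 0 : MvPolynomial (Fin 4) K), X 1 ^ 2 * X 3 - X 2 ^ 2} ∧
          (X 2 : MvPolynomial (Fin 4) K) ∉ Ideal.span {(X 0 : MvPolynomial (Fin 4) K), X 1 ^ 2 * X 3 - X 2 ^ 2}) ∧
        (X 1 ^ 2 * X 3 - X 2 ^ 2 : MvPolynomial (Fin 4) K) ≠ 0) :=
  ⟨fun 𝔮 _ _ hs h => H_top 𝔮 hs h, H_wild, H_coords, H_plane, H_surface_singular⟩

end GCertificatesA

section GCertificatesB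

open MvPolynomial
variable {K : Type*} [Field K]

/-! ## The second certificate file of the node, `GradeCutCertificates2.lean` (5886ffab) — its header, verbatim:

# GradeCutCertificates2 — decomp-res node «GradeCut» (lens-6 g28, critic row 204 RE-GRANT clause, pricing (g6)/(g1)):
# G₀ = `z³ + t⁴u²w²` (char 3) CERTIFIED DECIDED at g-height 2 — EVERY affine chart of EVERY blow-up on the way — and
# `Sing V(z, t²w − u²)` = the `w`-axis (H's singular line)

Companion of `GradeCutCertificates.lean` (§GCertificatesA: level `0` of G₀ — `TopFrozen` with surface part the plane
`P = V(z,t)` —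
and of H) and of `GradeCut.lean` (the law).  Same format and dictionary (file `DeltaCutSepCertificates`: (ord) `∃ s
∉ 𝔮, s·g ∈ 𝔮^m`;
WILD = `3`-power form; NEAR = transform `∈ 𝔫'³` with a generic cofactor; TAME = order-2 differential operator
extracting `c·e`, `c ∉ 𝔫`,
`e` a regular parameter (`s'·e ∉ 𝔫²`); NO-TOP = `s·g ∈ 𝔮³ ⟹ False`; (L) Rees charts of coordinate linear centres
`linChartSubst A e`
(`x_a ↦ x_a·x_e` for `a ∈ A ∖ {e}`); (R) coordinate linear subspaces and disjoint unions of them are regular).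
Coordinates `0 = z,
1 = t, 2 = u, 3 = w`, renamed per chart in the docstrings.  Where a chart polynomial COINCIDES LITERALLY with one of g26's P∞
polynomials the landed P∞ lemma is cited BY NAME (`Pinf_top`, `Pinf_mem_cube_sAxis`, `Pinf_mem_cube_wAxis`,
`Pinf_axes_nondegenerate`,
`Pinf_L1_lineChart_X0_noTop`, `Pinf_L1_lineChart_X2_noTop`).

THE G-RUN OF G₀ (law `GradeCut.gRun 3 ⟨(𝔸⁴, (G₀)), none⟩`):
* g-height 0 (§GCertificatesA, `G0_refFrozen_certificate`): `TopFrozen` — nothing pending, bad₀ = closed points of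
`P ∪ L` (`P = V(z,t)`,
  `L = V(z,u,w)`), reduced closure `V(z,tu,tw)` irregular at the origin, not a curve, SURFACE PART `P` REGULAR: the
graded hop FIRES
  and blows up `𝓘(P)` (`gHop_eq_grade`), pending stays `none`.
* g-height 0 → 1, centre `P = V(z,t)`, BOTH charts (§GCertificatesB): chart `t`: `G₀ = t³·F₁`, `F₁ = z'³ + t·u²w²`;
chart `z`: `G₀ =
  z³·(1 + z·t'⁴u²w²)` — NO top point (`G0_A_chart_z_noTop`); so the whole top locus of level 1 lives in chart `t`.
* g-height 1 (chart `t`, `F₁`): top₁ `= L₁ ∪ M ∪ M′` EXACTLY (`G0_L1_top`: `⊆`; `G0_L1_line`, `G0_L1_oldLines`: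
`⊇`), `L₁ = V(z',u,w)` the
  strict transform of `L` (WILD: `t·u²w² ∈ L₁⁴`, NEAR point over every closed point: bad), `M = V(z',t,u)` and `M′ =
V(z',t,w)` the two
  lines of the exceptional plane over the `w`- and `u`-axis of `P` — TAME off the origin (`G0_L1_tame_M`,
`G0_L1_tame_M'`: `∂_u∂_u F₁ =
  2w²·t`, `∂_w∂_w F₁ = 2u²·t`, `t` a regular parameter: the initial form `c·t·u²` resp. `c·t·w²` is NOT a cube) and
meeting `L₁` at the
  origin only (`(z',t,u) ⊔ (z',t,w) = 𝔫₀ ⊇ 𝓘(L₁)`).  So closure bad₁ `= L₁`, a coordinate LINE — REGULAR (R): the level is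
  separating-ACTIVE (`SepActive`), hence neither `TopFrozen` nor `CurveFrozen`: `gHop = refHop = sepHop` (`gHop_eq_refHop`,
  `refHop_eq_sep`), which performs STEP 1 (blow up `L₁`) and — the strict transform `M̃ ⊔ M̃′` of the old top locus
`top₁ ∖ L₁ = (M ∪ M′) ∖
  {0}` being a DISJOINT union of two lines, REGULAR (R) — STEP 2 (blow up `M̃ ⊔ M̃′`) in the same hop
(`sepHop_next_of_regular`).
* step 1, centre `L₁ = V(z',u,w)`, ALL THREE charts (§GCertificatesC): chart `u`: `F₁ = u³·F₂ᵘ`, `F₂ᵘ = z″³ +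
t·u·w″²` (= P∞ with `u ↔
  w`); chart `w`: `F₁ = w³·F₂ʷ`, `F₂ʷ = z″³ + t·u″²·w` (= g26's P∞ LITERALLY, `s = t`); chart `z'`: `F₁ = z'³·(1 +
z'·t·u″²w″²)` — NO top
  point (`G0_B_chart_z_noTop`).  Top of the step-1 stage: chart `u`: `M̃′ ∪ N₁` (`G0_Bu_top`, `G0_Bu_lines`; `M̃′ =
V(z″,t,w″)` the strict
  transform of `M′`, `N₁ = V(z″,u,w″)` the `t`-line of the new exceptional divisor `V(u)`); chart `w`: `M̃ ∪ N₁` (`Pinf_top`,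
  `Pinf_mem_cube_wAxis/sAxis`; `M̃ = V(z″,t,u″)`).  `M̃ ⊆ V(u″)` misses chart `u` (whose overlap with chart `w` is
`D(u″)`), `M̃′ ⊆ V(w″)`
  misses chart `w`, both miss chart `z'`: `M̃ ⊔ M̃′` is a DISJOINT union of coordinate lines — `OldTopRegular` HOLDS.
* step 2, centre `M̃ ⊔ M̃′`, ALL charts (§GCertificatesC): in chart `u` (centre `M̃′ = V(z″,t,w″)`): chart `t`: `F₂ᵘ
= t³·(z‴³ + u·w‴²)` — top
  `= Ñ₁ = V(z‴,u,w‴)` and TAME at EVERY point (`G0_Cu_chart_t_top`, `G0_Cu_chart_t_tame`: `∂_w∂_w = 2·u`, `u` a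
regular parameter); chart
  `z″`: `z″³·(1 + t'·u·w‴²)` NO top (`G0_Cu_chart_z_noTop`); chart `w″`: `w″³·(z‴³ + t'·u)` NO top
(`G0_Cu_chart_w_noTop`).  In chart `w`
  (centre `M̃ = V(z″,t,u″)`): chart `t`: `t³·(z‴³ + u‴²·w)` — top `= Ñ₁`, TAME everywhere (`G0_Cw_chart_t_top`,
`G0_Cw_chart_t_tame`:
  `∂_u∂_u = 2·w`); chart `z″`: `1 + t'·u‴²·w` NO top (`Pinf_L1_lineChart_X0_noTop` BY NAME); chart `u″`: `z‴³ + t'·w` NO top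
  (`Pinf_L1_lineChart_X2_noTop` BY NAME).  Over chart `z'` of step 1 and chart `z` of level 0 nothing changes (no
top point there;
  blow-ups are isomorphisms off their centres).
* g-height 2: bad₂ = ∅ in EVERY chart (the only top points lie on the line `Ñ₁`, all TAME): `BadEmpty`, nothing
pending — `GTerminates
  3 ⟨(𝔸⁴,(G₀)), none⟩` with `h = 2` (moving prefix: the grade move at 0, the separating move at 1), and
`wor_of_gTerminatesAt` turns it into
  a weak resolution from `SeqDimFour 5 3`.  G₀ — g27-FROZEN (`RefFrozen`, kind F-surface) — is DECIDED by the g28 law.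
ANNOTATIONS (dead moves, hand computations only — NO emptiness / inhabitant claim is drawn from them; pricing (g8)):
(α) centre = the
MEET LINE `V(z,u,w) = P₁ ∩ P₂` of two heavy planes `z^p + u^a·w^b` (`a, b ≥ p`): chart `u` gives `z'^p +
u^{a+b-p}·w'^b`, exponents grow
without bound once `max(a,b) ≥ 2p` — a PERPETUAL move, never chosen by the law (the surface part is blown up whole);
(β) LOW-FIRST on G₀
(centre = the singular point of `P ∪ L` first): chart `t` of the point blow-up gives `z'³ + t⁵·u'²·w'²`, a HEAVIER
exceptional plane
(`t`-exponent `5 > 4`) plus the old configuration — longer, not shorter; the law blows up the regular surface part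
`P` FIRST (HIGH-first)
and terminates at g-height 2 as certified here.

Provenance: HOME = run/shared/lean/pub/decomp-res, lens-6 g28 (unit decomp-res-lens-6-g28); `--supports
stmt-ResolutionOfSingularities-26971`.
Namespace `…Theorems.DeltaCutClasses`, sections `GCertificatesB` (level 0 → 1 and level 1), `GCertificatesC` (steps
1, 2 and level 2; H's
singular axis).  Imports the landed `Theorems.DeltaCutRefCertificates3` + `HarnessLib`; uses
`Rescue.BedZpeBinom4Centre.mul_mem_pow_add` by the
explicit `open … (mul_mem_pow_add)`; every declaration is new, no `private` helpers, no `def`s, no restatement of a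
landed sentence.

(Sources: Hironaka1967; CossartJannsenSaito2020 Def. 3.13 / Thm. 3.14, Ch. 8, Thm. 9.6; Hironaka1970;
CossartPiltant2019 Prop. 2.6;
CossartPiltant2008 §2; Giraud1975; Hironaka2005; EGAIV4 §16–§18; StacksProject 0804 / 0BIQ / 031I / 039P / 00PD; Matsumura1987
§28–§30; Kollar2007 Thm. 1.101.)
-/

/-! ### §GCertificatesB — G₀, THE GRADED HOP AT LEVEL 0 (centre the plane `P = V(z,t)`, both charts) AND LEVEL 1
(`F₁ = z'³ + t·u²w²`:
top `= L₁ ∪ M ∪ M′`, closure bad₁ `= L₁` regular, `M`, `M′` TAME) -/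

/-- **LEVEL 0 → 1: THE TWO REES CHARTS of the blow-up of the surface part `P = V(z,t)`** (dictionary (L),
`linChartSubst {0,1} e`):
chart `t`: `G₀(z't, t, u, w) = t³·(z'³ + t·u²w²)`; chart `z`: `G₀(z, t'z, u, w) = z³·(1 + z·t'⁴·u²w²)`. [new;
elementary] [folklore] -/
theorem G0_A_charts :
    aeval (linChartSubst (K := K) {0, 1} 1) (X 0 ^ 3 + X 1 ^ 4 * X 2 ^ 2 * X 3 ^ 2 : MvPolynomial (Fin 4) K) =
        X 1 ^ 3 * (X 0 ^ 3 + X 1 * X 2 ^ 2 * X 3 ^ 2) ∧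
      aeval (linChartSubst (K := K) {0, 1} 0) (X 0 ^ 3 + X 1 ^ 4 * X 2 ^ 2 * X 3 ^ 2 : MvPolynomial (Fin 4) K) =
        X 0 ^ 3 * (1 + X 0 * X 1 ^ 4 * X 2 ^ 2 * X 3 ^ 2) := by
  constructor <;> (simp [linChartSubst]; ring)

/-- **LEVEL 0 → 1, chart `z` — NO top point** (so the top locus of level 1 lies entirely in chart `t`, and so do all
later centres):
`1 + z·t'⁴u²w²` has no prime of order `≥ 3` (`∂_z` gives `t'⁴u²w² ∈ 𝔮`, then `1 ∈ 𝔮`). [new; elementary] [folklore] -/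
theorem G0_A_chart_z_noTop (𝔮 : Ideal (MvPolynomial (Fin 4) K)) [𝔮.IsPrime] {s : MvPolynomial (Fin 4) K} (hs : s ∉ 𝔮)
    (h : s * (1 + X 0 * X 1 ^ 4 * X 2 ^ 2 * X 3 ^ 2 : MvPolynomial (Fin 4) K) ∈ 𝔮 ^ 3) : False := by
  have hs2 : s ^ 2 ∉ 𝔮 := pow_not_mem 𝔮 hs 2
  have e00 := f_self K 0
  have e01 := f_ne K (i := 0) (j := 1) (by decide)
  have e02 := f_ne K (i := 0) (j := 2) (by decide)
  have e03 := f_ne K (i := 0) (j := 3) (by decide)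
  have d0 : pderiv 0 (1 + X 0 * X 1 ^ 4 * X 2 ^ 2 * X 3 ^ 2 : MvPolynomial (Fin 4) K) = X 1 ^ 4 * X 2 ^ 2 * X 3 ^ 2 := by
    simp only [map_add, Derivation.leibniz, Derivation.leibniz_pow, smul_eq_mul, nsmul_eq_mul, e00, e01, e02, e03, f_one]
    push_cast; ring
  have h1 := sq_mul_deriv_mem_pow 𝔮 h (pderiv 0)
  rw [d0] at h1
  have hm : (X 1 ^ 4 * X 2 ^ 2 * X 3 ^ 2 : MvPolynomial (Fin 4) K) ∈ 𝔮 :=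
    (‹𝔮.IsPrime›.mem_or_mem (Ideal.pow_le_self two_ne_zero h1)).resolve_left hs2
  have hf : (1 + X 0 * X 1 ^ 4 * X 2 ^ 2 * X 3 ^ 2 : MvPolynomial (Fin 4) K) ∈ 𝔮 := mem_of_sMul_mem_cube 𝔮 hs h
  have h1mem : (1 : MvPolynomial (Fin 4) K) ∈ 𝔮 := by
    have := Ideal.sub_mem _ hf (Ideal.mul_mem_left _ (X 0) hm)
    rwa [show (1 + X 0 * X 1 ^ 4 * X 2 ^ 2 * X 3 ^ 2 - X 0 * (X 1 ^ 4 * X 2 ^ 2 * X 3 ^ 2) : MvPolynomial (Fin 4) K) = 1 by ring]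
      at this
  exact one_not_mem_of_isPrime 𝔮 h1mem

end GCertificatesB

end Summit.ResolutionOfSingularities.ResolutionOfSingularities.Theorems.DeltaCutClasses
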